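import Summits.QuantumFields.BalabanUV.T4Continuum.Support.NE7FrameCorrectedCurlEnergyTower
import Summits.QuantumFields.BalabanUV.T4Continuum.Support.NE3HessBounds
import HarnessLib

/-!
# NE7HessDominatesCoarseCurl — THE FINE WILSON HESSIAN DOMINATES THE FRAME-CORRECTED COARSE MAXWELL ENERGY OF THE CONSTRAINT DIFFERENTIAL UP TO `O(ε)·(SCALED FINE MASS)`, d = 4,
# UNIFORMLY IN j, N: `Σ_P ‖curl_{V₀} ṽ(P) − frameComm(P)‖²_{HS∕n} ≤ (1+θ)·hess U X̃ X̃ (perWin) + ((1+θ)·14·#planes·ε + (1+θ⁻¹)·(6·eC)²·ε²)·L^{−2(j+1)}·‖X̃‖²_{ℓ²}`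
# (lineage `b2b-balaban-t4-ne7-p1`, gen 117, file F7; ROAD-G116 §7∕§9 (G1)+(G2) assembled — the kinematic half of the sliced curved lower bound)

Cell `pub-balaban`, rung (B)+1 sub-cell t4, CRUX PROVER NE7 #1 (OWNER of row NE7), generation 117.  §1 the SHARP-CURRENCY small-field lower bound of the Wilson Hessian density (the tree's
✓ `NE3HessBounds.hessPlaqAt_self_ge` drops to the operator norm `‖d_V X‖²∕N`; the B9 (3.10) identity ✓ `hessPlaqAt_self_eq` gives it in the normalised Hilbert–Schmidt currency of all the NE7
effective-form files): `hessPlaqAt V X X p′ ≥ nhsNormSq((d_V X)(p′)) − 7a·Σ_{b⊂∂p′}‖X(b)‖²`, summed `hess V X X W ≥ Σ_{p∈W} nhsNormSq(curl V X p) − 7a·Σ_{p∈W} bondSq X p`; §2 the four-bond squares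
over the period window are at most `2·#planes` times the `ℓ²` mass (`sum_bondSq_perWin_le`); §3 with F6's j-uniform frame-corrected letter (✓ `sqrt_frameCorrected_curl_energy_levelQ'_le`) and Peter–Paul:
for a class configuration `U` (`SmallField U (ε·L^{−2(j+1)})`, the class radius) and a skew fine torus field `X`, in `d = 4`,
  **`Σ_{P∈perWin N} nhsNormSq (curl_{V₀} ṽ P − frameComm P) ≤ (1+θ)·hess U X̃ X̃ (perWin 4 (tower L N (j+1))) + ((1+θ)·14·#planes·ε + (1+θ⁻¹)·36·eC²·ε²)·L^{−2(j+1)}·dirSq X̃ (periodBox (tower L N (j+1)))`**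
(`ṽ = (levelQ' L N j U X)̃`, `V₀ = cavgIter L (j+1) U`, every `θ > 0`) — the fine second variation of the Wilson action at a class background controls the (frame-corrected) coarse Maxwell energy
of the linearised constraint image up to `O(ε)` times the SCALED fine mass `L^{−2(j+1)}‖X̃‖²_{ℓ²}`, with NO j- or volume-dependence.
HONEST FRAMING: this is the (G1)+(G2) half of the sliced curved lower bound of ROAD-G116 §7 (G′); the multiplier term (NE7b's (G3)), the slice and the block-constrained Poincaré that bounds the
scaled fine mass of a gauge-fixed fibre element by coarse data are NOT here; nothing of Bałaban's asserted ((3.10) of [Balaban1985BackgroundPropagators], (48)∕(120) of [Balaban1985Averaging]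
context only); NOT (G′), NOT NE7 as a spine node, NOT NE3; spine 0∕9; finite T⁴ rung (B)+1 — NOT infinite volume, NOT mass gap, NOT BetaPertH, NOT Clay.
-/

set_option autoImplicit false

open scoped BigOperators Matrix Matrix.Norms.L2Operator
open NormedSpace Finset

namespace Summit.QuantumFields.BalabanUV.T4Continuum.NE7HessDominatesCoarseCurl

open Literature.MathematicalPhysics.QuantumFieldTheory.Balaban1983to89
open B7Prop1Explicit B7Prop2Explicit MatrixLog UnitaryModel
open T4AveragingDeficitWall (IsUnitaryCfg IsSkewDir SmallField curl curlAt dirSq)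
open T4AveragingDeficitWallBoundary (IsPeriodicCfg periodBox sum_periodBox_shift)
open AveragingDeficitPeriodicCounting (IsPeriodicDir)
open AveragingDeficitTorusChart (TDir chartDir isPeriodicDir_chartDir)
open AveragingDeficitNearIdentity (abs_nReTr_mul_le)
open AveragingDeficitTwoLevelPrep (twoLevelSmall skewSub)
open AveragingDeficitMultiLevelPrep (cavgIter tower levelQ')
open MatrixNorms (nhsNormSq nhsNormSq_nonneg nhsNormSq_le_opNorm_sq)
open MinimalActionLevels (perWin)
open NE3HessForm (hess hessPlaq hessPlaqAt dcurlAt)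
open NE3HessBounds (bondSq bondSqAt hessPlaqAt_self_eq norm_dcurlAt_self_le norm_curlAt_sq_le)
open NE3EnergyHessContTwoTerm (dirSq_nonneg)
open NE7RadIterUniform (radD)
open NE7StraightTowerCurlEnergy (eC mC eC_nonneg)
open NE7FrameCorrectedCurlEnergyTower (frameComm sqrt_frameCorrected_curl_energy_levelQ'_le)
open NE7FlatAverageCurlCommutation (isSkewDir_chartDir_id)

noncomputable section

variable {d : ℕ} {n : Type*} [Fintype n] [DecidableEq n]

/-! ## §1 The small-field lower bound of the Hessian density in the normalised Hilbert–Schmidt currency -/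

/-- **SHARP-CURRENCY LOWER BOUND FOR THE HESSIAN DENSITY**: for unitary `V`, skew `X` and a plaquette with `‖V(∂p′) − 1‖ ≤ a`:
`hessPlaqAt V X X p′ ≥ nhsNormSq ((d_V X)(p′)) − 7a·Σ_{b⊂∂p′}‖X(b)‖²` (B9 (3.10) shape ✓ `hessPlaqAt_self_eq`; `‖dcurl‖ ≤ 3·bondSq`, `‖d_V X‖² ≤ 4·bondSq`).
[cite: Balaban1985BackgroundPropagators, (3.10) p.391] -/
theorem hessPlaqAt_self_ge_nhs [Nonempty n] {V : Site d → Fin d → (Matrix n n ℂ)ˣ} (hV : IsUnitaryCfg V) {X : Site d → Fin d → Matrix n n ℂ}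
    (hX : IsSkewDir X) (z : Site d) (μ ν : Fin d) {a : ℝ}
    (hp : ‖((hol V z (plaqWord μ ν) : (Matrix n n ℂ)ˣ) : Matrix n n ℂ) - 1‖ ≤ a) :
    nhsNormSq (curlAt V X z μ ν) - 7 * a * bondSqAt X z μ ν ≤ hessPlaqAt V X X z μ ν := by
  rw [hessPlaqAt_self_eq hV hX]
  set D := dcurlAt V X X z μ ν
  set C := curlAt V X z μ ν
  set H := ((hol V z (plaqWord μ ν) : (Matrix n n ℂ)ˣ) : Matrix n n ℂ)
  have h2 : |nReTr ((D + C * C) * (H - 1))| ≤ ‖D + C * C‖ * ‖H - 1‖ := abs_nReTr_mul_le _ _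
  have h3 : ‖D + C * C‖ ≤ 3 * bondSqAt X z μ ν + 4 * bondSqAt X z μ ν := by
    refine (norm_add_le _ _).trans (add_le_add (norm_dcurlAt_self_le hV X z μ ν) ?_)
    calc ‖C * C‖ ≤ ‖C‖ * ‖C‖ := norm_mul_le _ _
      _ = ‖C‖ ^ 2 := by ring
      _ ≤ 4 * bondSqAt X z μ ν := norm_curlAt_sq_le hV X z μ ν
  have hB : 0 ≤ bondSqAt X z μ ν := by unfold NE3HessBounds.bondSqAt; positivity
  have h4 : nReTr ((D + C * C) * (H - 1)) ≤ 7 * a * bondSqAt X z μ ν := by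
    have := (le_abs_self _).trans h2
    have h5 : ‖D + C * C‖ * ‖H - 1‖ ≤ (7 * bondSqAt X z μ ν) * a :=
      mul_le_mul (by linarith) hp (norm_nonneg _) (by linarith)
    linarith
  linarith

/-- **SHARP-CURRENCY LOWER BOUND FOR THE HESSIAN FORM ON A WINDOW**: for unitary `V` in `SmallField V a` and skew `X`,
`hess V X X W ≥ Σ_{p∈W} nhsNormSq (curl V X p) − 7a·Σ_{p∈W} bondSq X p`. [cite: Balaban1985BackgroundPropagators, (3.10) p.391] -/
theorem hess_self_ge_nhs [Nonempty n] {V : Site d → Fin d → (Matrix n n ℂ)ˣ} (hV : IsUnitaryCfg V) {X : Site d → Fin d → Matrix n n ℂ}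
    (hX : IsSkewDir X) {a : ℝ} (hVa : SmallField V a) (W : Finset (T4AveragingDeficitWall.Plaq d)) :
    ∑ p ∈ W, nhsNormSq (curl V X p) - 7 * a * ∑ p ∈ W, bondSq X p ≤ hess V X X W := by
  unfold NE3HessForm.hess
  rw [Finset.mul_sum, ← Finset.sum_sub_distrib]
  refine Finset.sum_le_sum fun p _ => ?_
  exact hessPlaqAt_self_ge_nhs hV hX p.1 p.2.1.1 p.2.1.2 (hVa p.1 p.2.1.1 p.2.1.2 (ne_of_lt p.2.2))

/-! ## §2 The four-bond squares over the period window -/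

/-- **THE FOUR-BOND SQUARES OVER THE PERIOD WINDOW**: for an `M`-periodic `X`, `Σ_{p∈perWin M} bondSq X p ≤ 2·#planes·dirSq X (periodBox M)` (the shifted terms are re-centred by periodicity;
each plane reads two directions). [folklore] -/
theorem sum_bondSq_perWin_le {M : ℕ} (hM : 1 ≤ M) {X : Site d → Fin d → Matrix n n ℂ} (hXP : IsPeriodicDir X (M : ℤ)) :
    ∑ p ∈ perWin d M, bondSq X p ≤ 2 * (Fintype.card (T4AveragingDeficitWall.Plane d) : ℝ) * dirSq X (periodBox M) := by
  classical
  set A : Fin d → ℝ := fun κ => ∑ z ∈ periodBox M, ‖X z κ‖ ^ 2 with hA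
  have hA0 : ∀ κ, 0 ≤ A κ := fun κ => Finset.sum_nonneg fun _ _ => sq_nonneg _
  have hdirSq : dirSq X (periodBox M) = ∑ κ : Fin d, A κ := by
    unfold T4AveragingDeficitWall.dirSq; rw [Finset.sum_comm]
  -- re-centre the two shifted terms
  have hshift : ∀ (μ ν : Fin d), ∑ z ∈ periodBox M, ‖X (z + e μ) ν‖ ^ 2 = A ν := fun μ ν =>
    sum_periodBox_shift M hM (g := fun z => ‖X z ν‖ ^ 2) (fun x κ => by rw [hXP x κ ν]) (e μ)
  have hplane : ∀ π : T4AveragingDeficitWall.Plane d, ∑ z ∈ periodBox M, bondSq X (z, π) ≤ 2 * dirSq X (periodBox M) := by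
    intro π
    have hne : π.1.1 ≠ π.1.2 := ne_of_lt π.2
    have hsum : ∑ z ∈ periodBox M, bondSq X (z, π) = 2 * (A π.1.1 + A π.1.2) := by
      simp only [NE3HessBounds.bondSq, NE3HessBounds.bondSqAt, Finset.sum_add_distrib, hshift]
      simp only [hA]; ring
    have htwo : A π.1.1 + A π.1.2 ≤ ∑ κ : Fin d, A κ := by
      rw [← Finset.sum_pair hne]
      exact Finset.sum_le_sum_of_subset_of_nonneg (Finset.subset_univ _) fun κ _ _ => hA0 κ
    rw [hsum, hdirSq]; linarith
  rw [perWin, Finset.sum_product, Finset.sum_comm]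
  calc ∑ π : T4AveragingDeficitWall.Plane d, ∑ z ∈ periodBox M, bondSq X (z, π)
      ≤ ∑ _π : T4AveragingDeficitWall.Plane d, 2 * dirSq X (periodBox M) := Finset.sum_le_sum fun π _ => hplane π
    _ = 2 * (Fintype.card (T4AveragingDeficitWall.Plane d) : ℝ) * dirSq X (periodBox M) := by
        rw [Finset.sum_const, Finset.card_univ, nsmul_eq_mul]; ring

/-! ## §3 The assembly in d = 4 -/

omit [Fintype n] [DecidableEq n] in
/-- Squaring a root-form letter with Peter–Paul: `√X ≤ √E + c·√N` (`X, E, N ≥ 0`) gives `X ≤ (1+θ)E + (1+θ⁻¹)c²N` for every `θ > 0`. [folklore] -/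
theorem sq_of_sqrt_le_add {x E N c θ : ℝ} (hx : 0 ≤ x) (hE : 0 ≤ E) (hN : 0 ≤ N) (hθ : 0 < θ)
    (h : Real.sqrt x ≤ Real.sqrt E + c * Real.sqrt N) : x ≤ (1 + θ) * E + (1 + θ⁻¹) * (c ^ 2 * N) := by
  set α := Real.sqrt E with hα
  set β := Real.sqrt N with hβ
  have hα0 : 0 ≤ α := Real.sqrt_nonneg _
  have hβ0 : 0 ≤ β := Real.sqrt_nonneg _
  have hsq : x ≤ (α + c * β) ^ 2 := by
    calc x = Real.sqrt x ^ 2 := (Real.sq_sqrt hx).symm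
      _ ≤ (α + c * β) ^ 2 := pow_le_pow_left₀ (Real.sqrt_nonneg _) h 2
  have hθinv : θ⁻¹ * θ = 1 := inv_mul_cancel₀ hθ.ne'
  have hkey : 2 * (α * (c * β)) ≤ θ * α ^ 2 + θ⁻¹ * (c * β) ^ 2 := by
    have h0 : 0 ≤ θ⁻¹ * (θ * α - c * β) ^ 2 := mul_nonneg (inv_nonneg.mpr hθ.le) (sq_nonneg _)
    have e : θ⁻¹ * (θ * α - c * β) ^ 2 = θ * α ^ 2 + θ⁻¹ * (c * β) ^ 2 - 2 * (α * (c * β)) := by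
      have : θ⁻¹ * (θ * α - c * β) ^ 2 = (θ⁻¹ * θ) * θ * α ^ 2 + θ⁻¹ * (c * β) ^ 2 - 2 * ((θ⁻¹ * θ) * (α * (c * β))) := by ring
      rw [this, hθinv]; ring
    rw [e] at h0; linarith
  have hA : α ^ 2 = E := Real.sq_sqrt hE
  have hB : β ^ 2 = N := Real.sq_sqrt hN
  calc x ≤ (α + c * β) ^ 2 := hsq
    _ = α ^ 2 + (c * β) ^ 2 + 2 * (α * (c * β)) := by ring
    _ ≤ α ^ 2 + (c * β) ^ 2 + (θ * α ^ 2 + θ⁻¹ * (c * β) ^ 2) := by linarith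
    _ = (1 + θ) * E + (1 + θ⁻¹) * (c ^ 2 * N) := by rw [mul_pow, hA, hB]; ring

/-- **THE FINE WILSON HESSIAN DOMINATES THE FRAME-CORRECTED COARSE MAXWELL ENERGY OF THE CONSTRAINT DIFFERENTIAL, d = 4, j-UNIFORM**: for `L ≥ 2`, `N ≥ 1`, `0 ≤ ε` under the three
smallness lines of ✓ `towerB_class_le` (depending on `L` and `card n` only), every unitary `(tower L N (j+1))`-periodic `U` with `SmallField U (ε·L^{−2(j+1)})`, every skew fine torus field
`X ∈ skewSub 4 n (L·tower L N j)` (`X̃ = chartDir id X`), and every `θ > 0`: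
`Σ_{P∈perWin N} nhsNormSq (curl V₀ ṽ P − frameComm P) ≤ (1+θ)·hess U X̃ X̃ (perWin 4 (tower L N (j+1))) + ((1+θ)·(14·#planes)·ε + (1+θ⁻¹)·36·(eC 4 L ν)²·ε²)·(L⁻¹)^{2(j+1)}·dirSq X̃ (periodBox (tower L N (j+1)))`,
`ṽ = chartDir id N ↑(levelQ' L N j U X)`, `V₀ = cavgIter L (j+1) U`, `ν = card n`, `#planes = card (Plane 4)`. [cite: Balaban1985Averaging, (48) p.25; Balaban1985BackgroundPropagators, (3.10) p.391] -/
theorem frameCorrected_coarse_curl_le_hess [Nonempty n] {L N : ℕ} [NeZero L] [NeZero N] (hL : 2 ≤ L) (hN : 1 ≤ N) {ε : ℝ} (hε : 0 ≤ ε)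
    (hεD : 4 * ε * radD 4 L * (((L : ℝ) ^ 2)⁻¹) ^ 2 ≤ 1) (hεT : twoLevelSmall 4 L * (2 * ε * ((L : ℝ) ^ 2)⁻¹) ≤ 1)
    (hεM : 8 * (L : ℝ) * mC 4 L (Fintype.card n) * ε * ((L : ℝ) ^ 2)⁻¹ ≤ 1) (j : ℕ)
    {U : Site 4 → Fin 4 → (Matrix n n ℂ)ˣ} (hU : IsUnitaryCfg U) (hUP : IsPeriodicCfg U ((tower L N (j + 1) : ℕ) : ℤ))
    (hUx : SmallField U (ε * (((L : ℝ) ^ 2)⁻¹) ^ (j + 1)))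
    {X : TDir 4 n (L * tower L N j)} (hX : X ∈ skewSub 4 n (L * tower L N j)) {θ : ℝ} (hθ : 0 < θ) :
    ∑ P ∈ perWin 4 N, nhsNormSq
        (curl (cavgIter L (j + 1) U) (chartDir (ContinuousLinearMap.id ℝ (Matrix n n ℂ)) N ((levelQ' L N j U X : ↥(skewSub 4 n N)) : TDir 4 n N)) P
          - frameComm L j U (chartDir (ContinuousLinearMap.id ℝ (Matrix n n ℂ)) (L * tower L N j) X) P.1 P.2.1.1 P.2.1.2)
      ≤ (1 + θ) * hess U (chartDir (ContinuousLinearMap.id ℝ (Matrix n n ℂ)) (L * tower L N j) X) (chartDir (ContinuousLinearMap.id ℝ (Matrix n n ℂ)) (L * tower L N j) X)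
            (perWin 4 (tower L N (j + 1)))
        + ((1 + θ) * (14 * (Fintype.card (T4AveragingDeficitWall.Plane 4) : ℝ) * ε) + (1 + θ⁻¹) * (36 * eC 4 L (Fintype.card n) ^ 2 * ε ^ 2))
          * ((L : ℝ)⁻¹) ^ (2 * (j + 1)) * dirSq (chartDir (ContinuousLinearMap.id ℝ (Matrix n n ℂ)) (L * tower L N j) X) (periodBox (tower L N (j + 1))) := by
  have hT1 : 1 ≤ tower L N (j + 1) := Nat.one_le_iff_ne_zero.mpr (AveragingDeficitMultiLevelPrep.tower_ne_zero L N (j + 1))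
  have hXts : IsSkewDir (chartDir (ContinuousLinearMap.id ℝ (Matrix n n ℂ)) (L * tower L N j) X) := isSkewDir_chartDir_id hX
  have hXtP : IsPeriodicDir (chartDir (ContinuousLinearMap.id ℝ (Matrix n n ℂ)) (L * tower L N j) X) ((tower L N (j + 1) : ℕ) : ℤ) :=
    isPeriodicDir_chartDir (ContinuousLinearMap.id ℝ (Matrix n n ℂ)) (L * tower L N j) X
  -- abbreviations (plain `have`-named reals, no `set`)
  obtain ⟨E₀, hE₀⟩ : ∃ E₀ : ℝ, E₀ = ∑ p ∈ perWin 4 (tower L N (j + 1)), nhsNormSq (curl U (chartDir (ContinuousLinearMap.id ℝ (Matrix n n ℂ)) (L * tower L N j) X) p) := ⟨_, rfl⟩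
  obtain ⟨N₀, hN₀⟩ : ∃ N₀ : ℝ, N₀ = ∑ b ∈ periodBox (tower L N (j + 1)), ∑ κ : Fin 4, nhsNormSq (chartDir (ContinuousLinearMap.id ℝ (Matrix n n ℂ)) (L * tower L N j) X b κ) := ⟨_, rfl⟩
  obtain ⟨S, hS⟩ : ∃ S : ℝ, S = dirSq (chartDir (ContinuousLinearMap.id ℝ (Matrix n n ℂ)) (L * tower L N j) X) (periodBox (tower L N (j + 1))) := ⟨_, rfl⟩
  obtain ⟨H, hH⟩ : ∃ H : ℝ, H = hess U (chartDir (ContinuousLinearMap.id ℝ (Matrix n n ℂ)) (L * tower L N j) X) (chartDir (ContinuousLinearMap.id ℝ (Matrix n n ℂ)) (L * tower L N j) X)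
      (perWin 4 (tower L N (j + 1))) := ⟨_, rfl⟩
  have hE₀0 : 0 ≤ E₀ := by rw [hE₀]; exact Finset.sum_nonneg fun _ _ => nhsNormSq_nonneg _
  have hN₀0 : 0 ≤ N₀ := by rw [hN₀]; exact Finset.sum_nonneg fun _ _ => Finset.sum_nonneg fun _ _ => nhsNormSq_nonneg _
  have hS0 : 0 ≤ S := by rw [hS]; exact dirSq_nonneg _ _
  have hK0 : 0 ≤ eC 4 L (Fintype.card n : ℝ) := eC_nonneg 4 L
  have hq0 : 0 ≤ (L : ℝ)⁻¹ := by positivity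
  -- F6 (root form), squared with Peter–Paul
  have hF6 := sqrt_frameCorrected_curl_energy_levelQ'_le hL hN hε hεD hεT hεM j hU hUP hUx hX
  rw [← hE₀, ← hN₀] at hF6
  have hmain := sq_of_sqrt_le_add (Finset.sum_nonneg fun _ _ => nhsNormSq_nonneg _) hE₀0 hN₀0 hθ hF6
  -- the fine Hessian bounds the fine curl energy
  have hhess := hess_self_ge_nhs hU hXts hUx (perWin 4 (tower L N (j + 1)))
  rw [← hE₀, ← hH] at hhess
  have hbond := sum_bondSq_perWin_le (d := 4) hT1 hXtP
  rw [← hS] at hbond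
  have hqq : (((L : ℝ) ^ 2)⁻¹) ^ (j + 1) = ((L : ℝ)⁻¹) ^ (2 * (j + 1)) := by
    rw [inv_pow, inv_pow, ← pow_mul]
  have hE₀le : E₀ ≤ H + 14 * (Fintype.card (T4AveragingDeficitWall.Plane 4) : ℝ) * ε * ((L : ℝ)⁻¹) ^ (2 * (j + 1)) * S := by
    rw [hqq] at hhess
    have h7 : 0 ≤ 7 * (ε * ((L : ℝ)⁻¹) ^ (2 * (j + 1))) := by positivity
    have := mul_le_mul_of_nonneg_left hbond h7
    nlinarith
  -- N₀ ≤ S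
  have hN₀S : N₀ ≤ S := by
    rw [hN₀, hS]; unfold T4AveragingDeficitWall.dirSq
    exact Finset.sum_le_sum fun b _ => Finset.sum_le_sum fun κ _ => nhsNormSq_le_opNorm_sq _
  have hθ1 : 0 ≤ 1 + θ := by linarith
  have hθ2 : 0 ≤ 1 + θ⁻¹ := by positivity
  have hcc : (6 * eC 4 L (Fintype.card n) * ε * ((L : ℝ)⁻¹) ^ (j + 1)) ^ 2 = 36 * eC 4 L (Fintype.card n) ^ 2 * ε ^ 2 * ((L : ℝ)⁻¹) ^ (2 * (j + 1)) := by
    rw [pow_mul]; ring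
  rw [hcc] at hmain
  rw [← hH, ← hS]
  have h1 := mul_le_mul_of_nonneg_left hE₀le hθ1
  have h2 : 36 * eC 4 L (Fintype.card n) ^ 2 * ε ^ 2 * ((L : ℝ)⁻¹) ^ (2 * (j + 1)) * N₀
      ≤ 36 * eC 4 L (Fintype.card n) ^ 2 * ε ^ 2 * ((L : ℝ)⁻¹) ^ (2 * (j + 1)) * S := mul_le_mul_of_nonneg_left hN₀S (by positivity)
  have h3 := mul_le_mul_of_nonneg_left h2 hθ2
  nlinarith

end

end Summit.QuantumFields.BalabanUV.T4Continuum.NE7HessDominatesCoarseCurl
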